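import Summits.AnomalousDissipation.AnomalousDissipation.Theorems.EnsembleCeiling.Negative.BeltramiFat

/-!
# Negative knowledge for the crux `EnsembleCeiling` (stmt-AnomalousDissipation-14090), V:
# planar single-shell cellular forces are fat

Crux `TaylorCertificates.EnsembleCeiling` (route `AnomalousDissipation/TaylorCertificates`, rank 4),
cdisprove seat `refuter-cdisprove-stmt-AnomalousDissipation-14090-0`. Second discharge of the
single-shell Euler-steady mechanism of Part IV (`BeltramiFat`), now on the PLANAR side of the
Kishimoto–Yoneda dichotomy: the two-mode horizontal fields on the shell `|k|² = 2`,
`f = Re(e_{(1,1,0)} P(1,-1,0)) + Re(e_{(1,-1,0)} Q(1,1,0))` (`P, Q ∈ ℂ`), i.e. the oblique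
cellular flows `a sin(2π(x₁+x₂)+α)(1,-1,0) + b sin(2π(x₁-x₂)+β)(1,1,0)` — for `P = Q = -i/2` the
Taylor–Green / four-roll-mill cellular force `(sin 2πx₁ cos 2πx₂, -cos 2πx₁ sin 2πx₂, 0)`. Their
stream function is a Laplace eigenfunction, so `(f·∇)f` is a gradient; by the pair formula the
inertial term against a divergence-free `w` is `4π Im[PQ conj ŵ₁(2,0,0)] = 0` at the sum frequency
(`(2,0,0)·ŵ = 0`) and the imaginary part of a real number at the difference frequency `(0,±2,0)`.
Hence (`not_ceiling_cellular`) these forces have no ensemble ceiling: planar cellular forcing is dead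
for the crux, in any horizontal orientation and phase. Nothing here asserts a Theses statement.
-/

noncomputable section

open MeasureTheory UnitAddTorus Matrix
open scoped InnerProductSpace ENNReal ComplexConjugate

namespace Summit.AnomalousDissipation.AnomalousDissipation.Theorems.EnsembleCeiling.Negative

open Literature.Analysis.FunctionSpaces Literature.Analysis.FluidPDE
open Summit.AnomalousDissipation.AnomalousDissipation.Theorems.TaylorCertificatePair.Negative

/-- **Planar single-shell cellular fields are weakly Euler-steady**: the inertial term of
`Re(e_{(1,1,0)} P(1,-1,0)) + Re(e_{(1,-1,0)} Q(1,1,0))` vanishes against every smooth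
divergence-free `w`. -/
theorem cellular_inertial_eq_zero (P Q : ℂ) {w : (UnitAddTorus (Fin 3)) → (EuclideanSpace ℝ (Fin 3))}
    (hw : Torus.IsSmooth w) (hdw : Torus.IsDivFree w) :
    ∫ x, ⟪Torus.fderiv w x ((∑ mm, Torus.realTrigPoly {(![![1, 1, 0], ![1, -1, 0]] : Fin 2 → (Fin 3 → ℤ)) mm}
        (fun _ => (![P • (WithLp.toLp 2 ![1, -1, 0] : EuclideanSpace ℂ (Fin 3)),
                    Q • (WithLp.toLp 2 ![1, 1, 0] : EuclideanSpace ℂ (Fin 3))] : Fin 2 → EuclideanSpace ℂ (Fin 3)) mm)) x),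
        (∑ mm, Torus.realTrigPoly {(![![1, 1, 0], ![1, -1, 0]] : Fin 2 → (Fin 3 → ℤ)) mm}
        (fun _ => (![P • (WithLp.toLp 2 ![1, -1, 0] : EuclideanSpace ℂ (Fin 3)),
                    Q • (WithLp.toLp 2 ![1, 1, 0] : EuclideanSpace ℂ (Fin 3))] : Fin 2 → EuclideanSpace ℂ (Fin 3)) mm)) x⟫_ℝ = 0 := by
  rw [inertial_modes hw]
  simp only [Fin.sum_univ_two, Matrix.cons_val_zero, Matrix.cons_val_one]
  have a11 : ((![1, 1, 0] : Fin 3 → ℤ) + ![1, 1, 0]) = ![2, 2, 0] := by decide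
  have a12 : ((![1, 1, 0] : Fin 3 → ℤ) + ![1, -1, 0]) = ![2, 0, 0] := by decide
  have a21 : ((![1, -1, 0] : Fin 3 → ℤ) + ![1, 1, 0]) = ![2, 0, 0] := by decide
  have a22 : ((![1, -1, 0] : Fin 3 → ℤ) + ![1, -1, 0]) = ![2, -2, 0] := by decide
  have d11 : ((![1, 1, 0] : Fin 3 → ℤ) - ![1, 1, 0]) = 0 := by decide
  have d21 : ((![1, -1, 0] : Fin 3 → ℤ) - ![1, 1, 0]) = -![0, 2, 0] := by decide
  have d12 : ((![1, 1, 0] : Fin 3 → ℤ) - ![1, -1, 0]) = ![0, 2, 0] := by decide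
  have d22 : ((![1, -1, 0] : Fin 3 → ℤ) - ![1, -1, 0]) = 0 := by decide
  have hcs : ∀ κ : Fin 3 → ℤ, mFourierCoeff (EuclideanSpace.complexify ∘ w) (-κ) =
      EuclideanSpace.conjVec (mFourierCoeff (EuclideanSpace.complexify ∘ w) κ) :=
    Torus.isConjSymm_mFourierCoeff hw.integrable
  simp only [a11, a12, a21, a22, d11, d21, d12, d22, hcs]
  simp only [dotProduct, Fin.sum_univ_three, WithLp.ofLp_smul, Pi.smul_apply, Pi.neg_apply,
    Pi.zero_apply, smul_eq_mul, Matrix.cons_val_zero, Matrix.cons_val_one, Matrix.cons_val_two, Matrix.head_cons,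
    Matrix.tail_cons, inner_smul_right, PiLp.inner_apply, RCLike.inner_apply, EuclideanSpace.conjVec_apply,
    Complex.conj_conj, neg_zero, Int.cast_zero, Int.cast_neg, Int.cast_ofNat,
    zero_mul, mul_zero, one_mul, mul_one, zero_add, add_zero]
  have r200 := hdw.sum_mul_mFourierCoeff_eq_zero hw ![2, 0, 0]
  have r020 := hdw.sum_mul_mFourierCoeff_eq_zero hw ![0, 2, 0]
  simp only [Fin.sum_univ_three, Matrix.cons_val_zero, Matrix.cons_val_one, Matrix.cons_val_two,
    Matrix.head_cons, Matrix.tail_cons, Int.cast_zero, Int.cast_ofNat, zero_mul, zero_add, add_zero] at r200 r020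
  have s200 : (mFourierCoeff (EuclideanSpace.complexify ∘ w) ![2, 0, 0]).ofLp 0 = 0 := by
    linear_combination (2 : ℂ)⁻¹ * r200
  have s020 : (mFourierCoeff (EuclideanSpace.complexify ∘ w) ![0, 2, 0]).ofLp 1 = 0 := by
    linear_combination (2 : ℂ)⁻¹ * r020
  simp only [s200, s020, map_zero, mul_zero, zero_mul, zero_add, add_zero]
  simp only [show (2 : ℂ) = ((2 : ℝ) : ℂ) by norm_num]
  simp only [Complex.mul_im, Complex.mul_re, Complex.add_im, Complex.add_re, Complex.neg_re, Complex.neg_im,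
    Complex.conj_re, Complex.conj_im, Complex.ofReal_re, Complex.ofReal_im, Complex.one_re, Complex.one_im,
    Complex.zero_im]
  ring

/-- The cellular frequencies `(1,1,0)`, `(1,-1,0)` lie on the shell `|k|² = 2`. -/
theorem cellular_freqNormSq : ∀ m, Torus.freqNormSq ((![![1, 1, 0], ![1, -1, 0]] : Fin 2 → (Fin 3 → ℤ)) m) = 2 := by
  intro m
  fin_cases m <;> simp [Torus.freqNormSq, Fin.sum_univ_three] <;> norm_num

/-- The cellular frequencies are in normal form. -/
theorem cellular_normalForm : ∀ m m' : Fin 2, m ≠ m' →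
    (![![1, 1, 0], ![1, -1, 0]] : Fin 2 → (Fin 3 → ℤ)) m ≠ (![![1, 1, 0], ![1, -1, 0]] : Fin 2 → (Fin 3 → ℤ)) m' ∧
    (![![1, 1, 0], ![1, -1, 0]] : Fin 2 → (Fin 3 → ℤ)) m ≠ -(![![1, 1, 0], ![1, -1, 0]] : Fin 2 → (Fin 3 → ℤ)) m' := by
  decide

/-- The cellular amplitudes are transversal. -/
theorem cellular_transversal (P Q : ℂ) : ∀ m,
    ((fun j => ((((![![1, 1, 0], ![1, -1, 0]] : Fin 2 → (Fin 3 → ℤ)) m)) j : ℂ)) ⬝ᵥ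
      (WithLp.ofLp (((![P • (WithLp.toLp 2 ![1, -1, 0] : EuclideanSpace ℂ (Fin 3)),
                    Q • (WithLp.toLp 2 ![1, 1, 0] : EuclideanSpace ℂ (Fin 3))] : Fin 2 → EuclideanSpace ℂ (Fin 3)) m)))) = 0 := by
  intro m
  fin_cases m <;>
    simp [dotProduct, Fin.sum_univ_three, Matrix.cons_val_zero, Matrix.cons_val_one, Matrix.cons_val_two,
      Matrix.head_cons, Matrix.tail_cons]

/-- Energy of the cellular force: `∫ ‖f‖² = ‖P‖² + ‖Q‖²`. -/
theorem cellular_integral_norm_sq (P Q : ℂ) :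
    ∫ x, ‖(∑ mm, Torus.realTrigPoly {(![![1, 1, 0], ![1, -1, 0]] : Fin 2 → (Fin 3 → ℤ)) mm}
        (fun _ => (![P • (WithLp.toLp 2 ![1, -1, 0] : EuclideanSpace ℂ (Fin 3)),
                    Q • (WithLp.toLp 2 ![1, 1, 0] : EuclideanSpace ℂ (Fin 3))] : Fin 2 → EuclideanSpace ℂ (Fin 3)) mm)) x‖ ^ 2 =
      ‖P‖ ^ 2 + ‖Q‖ ^ 2 := by
  rw [integral_norm_sq_modes_of_normalForm (fun m => ?_) cellular_normalForm]
  · simp only [Fin.sum_univ_two, Matrix.cons_val_zero, Matrix.cons_val_one, EuclideanSpace.norm_eq]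
    simp [Fin.sum_univ_three]
    ring
  · intro h0
    have := cellular_freqNormSq m
    rw [h0, Torus.freqNormSq_zero] at this
    norm_num at this

/-- **Planar cellular forces have no ensemble ceiling** (`(P,Q) ≠ 0`): the laminar cellular state
`f/(8π²ν)` is an exact steady state of `NS_ν(f)` for every `ν` (Dirac stationary statistics of
energy `(‖P‖²+‖Q‖²)/(64π⁴ν²)`). In particular the Taylor–Green / four-roll-mill force
`(sin 2πx₁ cos 2πx₂, -cos 2πx₁ sin 2πx₂, 0)` (`P = Q = -i/2`) is dead for the crux. -/
theorem not_ceiling_cellular {P Q : ℂ} (h : P ≠ 0 ∨ Q ≠ 0) :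
    ¬ ∃ (E ν₀ : ℝ), 0 < ν₀ ∧ ∀ ν : ℝ, 0 < ν → ν < ν₀ → ∀ μ : Measure (Torus.energySpace (Fin 3)),
      Torus.IsStationaryStatisticalSolution ν
        (∑ mm, Torus.realTrigPoly {(![![1, 1, 0], ![1, -1, 0]] : Fin 2 → (Fin 3 → ℤ)) mm}
          (fun _ => (![P • (WithLp.toLp 2 ![1, -1, 0] : EuclideanSpace ℂ (Fin 3)),
                      Q • (WithLp.toLp 2 ![1, 1, 0] : EuclideanSpace ℂ (Fin 3))] : Fin 2 → EuclideanSpace ℂ (Fin 3)) mm)) μ →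
        Integrable (fun v : (Torus.energySpace (Fin 3)) => ‖v‖ ^ 2) μ → Torus.ensembleEnergy μ ≤ E := by
  refine not_ceiling_of_singleShell_eulerSteady cellular_freqNormSq two_pos (cellular_transversal P Q)
    (fun w hw hdw _ => cellular_inertial_eq_zero P Q hw hdw) ?_
  rw [cellular_integral_norm_sq]
  rcases h with hP | hQ
  · have := norm_pos_iff.2 hP; positivity
  · have := norm_pos_iff.2 hQ; positivity

end Summit.AnomalousDissipation.AnomalousDissipation.Theorems.EnsembleCeiling.Negative
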